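import Summits.CriticalPhenomena.PercolationContinuityZ3.Theorems.PercNearOneGluingNoHeavyLowerTailSahiSliceMinimumBernstein
import Summits.CriticalPhenomena.PercolationContinuityZ3.Theorems.SahiMasterFamilyComparableStep

/-!
# `NoHeavyLowerTail` (crux stmt-CriticalPhenomena-4575), Sahi programme P2 (gen 16): the slice minimum principle — indeed
# the Bernstein form — at EVERY coin for NESTED triples `U₁ ⊆ U₂ ⊆ U₃`

Support file (`--supports stmt-CriticalPhenomena-4575`; companion of `…SahiSliceMinimum`, `…SahiSliceMinimumBernstein`,
`…SahiSliceMinimumPair`).  Third proved family of the SLICE MINIMUM PRINCIPLE (`SliceMinimumPrinciple 3` ⟹ Kahn's Conjecture 5).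

THE ARGUMENT.  For nested events `E_3(1_{U₁},1_{U₂},1_{U₃}) = μ(U₁)·(1 − μ(U₂))·(2 − μ(U₃))` (`sahiE_three_chain_update`): along
a coin the fibre is a product of THREE NONNEGATIVE AFFINE functions `ℓ_i(s) = (1−s)a_i + s b_i`.  Its Bernstein coefficients are
`β₀ = a₁a₂a₃`, `β₁ = (b₁a₂a₃ + a₁b₂a₃ + a₁a₂b₃)/3`, `β₂ = (a₁b₂b₃ + b₁a₂b₃ + b₁b₂a₃)/3`, `β₃ = b₁b₂b₃`, and by the AM–GM
inequality `β₁³ ≥ β₀²β₃`, `β₂³ ≥ β₀β₃²`; so BOTH MIDDLE COEFFICIENTS DOMINATE `min(β₀, β₃)` (`prod3_affine_middle_ge_min`) and the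
fibre, a convex combination of its control values, dominates the smaller endpoint (`prod3_affine_ge_min`, via `bernstein_ge_min`):
**`min(E_3 of the two e-sections) ≤ E_3`** at every coin, for every product measure, for every nested triple of events
(monotonicity is not even needed) — `chain_slice_min_le`, `sliceMinimum_chain`.  Everything here is proved; axioms standard.
[this work]
-/

noncomputable section

open scoped Classical

namespace Summit.CriticalPhenomena.PercolationContinuityZ3.Theorems

open Finset Function
open Literature.Combinatorics.Sahi2008
open Literature.Probability.Percolation.DecisionTree (ind ind_of_mem ind_of_not_mem ind_nonneg)

namespace SahiSliceMinimum

variable {ι : Type} [Fintype ι]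

/-! ### AM–GM for three and the Bernstein coefficients of a product of three affine functions -/

/-- `(A+B+C)³ ≥ 27ABC` for `A, B, C ≥ 0` (AM–GM, as a sum of squares). [folklore] -/
theorem amgm3_cubed {A B C : ℝ} (hA : 0 ≤ A) (hB : 0 ≤ B) (hC : 0 ≤ C) : 27 * (A * B * C) ≤ (A + B + C) ^ 3 := by
  nlinarith [mul_nonneg (add_nonneg (add_nonneg hA hB) hC) (sq_nonneg (A - B)),
    mul_nonneg (add_nonneg (add_nonneg hA hB) hC) (sq_nonneg (B - C)),
    mul_nonneg (add_nonneg (add_nonneg hA hB) hC) (sq_nonneg (C - A)),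
    mul_nonneg hA (sq_nonneg (B - C)), mul_nonneg hB (sq_nonneg (C - A)), mul_nonneg hC (sq_nonneg (A - B))]

/-- Cube roots are monotone: `m³ ≤ x³`, `x, m ≥ 0` give `m ≤ x`. [folklore] -/
theorem le_of_cube_le {x m : ℝ} (hx : 0 ≤ x) (hm : 0 ≤ m) (h : m ^ 3 ≤ x ^ 3) : m ≤ x := by
  rcases le_or_gt m x with hle | hlt
  · exact hle
  exfalso
  have hmpos : 0 < m := lt_of_le_of_lt hx hlt
  have h1 : 0 < m - x := sub_pos.2 hlt
  have h2 : 0 < m ^ 2 + m * x + x ^ 2 := by nlinarith [mul_pos hmpos hmpos, mul_nonneg hm hx, sq_nonneg x]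
  nlinarith [mul_pos h1 h2]

/-- **The middle Bernstein coefficients of a product of three nonnegative affine functions dominate the smaller endpoint**:
with `ℓ_i(s) = (1−s)a_i + s b_i`, `a_i, b_i ≥ 0`: `(b₁a₂a₃ + a₁b₂a₃ + a₁a₂b₃)/3 ≥ min(a₁a₂a₃, b₁b₂b₃)` and symmetrically
(AM–GM: `β₁³ ≥ β₀²β₃`). [this work] -/
theorem prod3_affine_middle_ge_min {a₁ a₂ a₃ b₁ b₂ b₃ : ℝ} (ha₁ : 0 ≤ a₁) (ha₂ : 0 ≤ a₂) (ha₃ : 0 ≤ a₃) (hb₁ : 0 ≤ b₁)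
    (hb₂ : 0 ≤ b₂) (hb₃ : 0 ≤ b₃) :
    min (a₁ * a₂ * a₃) (b₁ * b₂ * b₃) ≤ (b₁ * a₂ * a₃ + a₁ * b₂ * a₃ + a₁ * a₂ * b₃) / 3 := by
  set m := min (a₁ * a₂ * a₃) (b₁ * b₂ * b₃) with hm
  have hβ0 : 0 ≤ a₁ * a₂ * a₃ := mul_nonneg (mul_nonneg ha₁ ha₂) ha₃
  have hβ3 : 0 ≤ b₁ * b₂ * b₃ := mul_nonneg (mul_nonneg hb₁ hb₂) hb₃
  have hm0 : 0 ≤ m := le_min hβ0 hβ3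
  have hmle0 : m ≤ a₁ * a₂ * a₃ := min_le_left _ _
  have hmle3 : m ≤ b₁ * b₂ * b₃ := min_le_right _ _
  have hA : 0 ≤ b₁ * a₂ * a₃ := mul_nonneg (mul_nonneg hb₁ ha₂) ha₃
  have hB : 0 ≤ a₁ * b₂ * a₃ := mul_nonneg (mul_nonneg ha₁ hb₂) ha₃
  have hC : 0 ≤ a₁ * a₂ * b₃ := mul_nonneg (mul_nonneg ha₁ ha₂) hb₃
  have hx : 0 ≤ (b₁ * a₂ * a₃ + a₁ * b₂ * a₃ + a₁ * a₂ * b₃) / 3 := by positivity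
  refine le_of_cube_le hx hm0 ?_
  have hag := amgm3_cubed hA hB hC
  have hprod : (b₁ * a₂ * a₃) * (a₁ * b₂ * a₃) * (a₁ * a₂ * b₃) = (a₁ * a₂ * a₃) ^ 2 * (b₁ * b₂ * b₃) := by ring
  -- `m³ ≤ β₀²β₃ ≤ β₁³`
  have hm3 : m ^ 3 ≤ (a₁ * a₂ * a₃) ^ 2 * (b₁ * b₂ * b₃) := by
    have h1 : m ^ 2 ≤ (a₁ * a₂ * a₃) ^ 2 := pow_le_pow_left₀ hm0 hmle0 2
    calc m ^ 3 = m ^ 2 * m := by ring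
      _ ≤ (a₁ * a₂ * a₃) ^ 2 * (b₁ * b₂ * b₃) := mul_le_mul h1 hmle3 hm0 (pow_nonneg hβ0 2)
  calc m ^ 3 ≤ (a₁ * a₂ * a₃) ^ 2 * (b₁ * b₂ * b₃) := hm3
    _ = (b₁ * a₂ * a₃) * (a₁ * b₂ * a₃) * (a₁ * a₂ * b₃) := hprod.symm
    _ ≤ ((b₁ * a₂ * a₃ + a₁ * b₂ * a₃ + a₁ * a₂ * b₃) / 3) ^ 3 := by nlinarith [hag]

/-- **A product of three nonnegative affine functions on `[0,1]` dominates its smaller endpoint value.** [this work] -/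
theorem prod3_affine_ge_min {s a₁ a₂ a₃ b₁ b₂ b₃ : ℝ} (hs0 : 0 ≤ s) (hs1 : s ≤ 1) (ha₁ : 0 ≤ a₁) (ha₂ : 0 ≤ a₂)
    (ha₃ : 0 ≤ a₃) (hb₁ : 0 ≤ b₁) (hb₂ : 0 ≤ b₂) (hb₃ : 0 ≤ b₃) :
    min (a₁ * a₂ * a₃) (b₁ * b₂ * b₃) ≤ ((1 - s) * a₁ + s * b₁) * ((1 - s) * a₂ + s * b₂) * ((1 - s) * a₃ + s * b₃) := by
  have h1 := prod3_affine_middle_ge_min ha₁ ha₂ ha₃ hb₁ hb₂ hb₃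
  have h2 := prod3_affine_middle_ge_min hb₁ hb₂ hb₃ ha₁ ha₂ ha₃
  rw [min_comm] at h2
  have key := bernstein_ge_min hs0 hs1 (min_le_left (a₁ * a₂ * a₃) (b₁ * b₂ * b₃)) h1 h2
    (min_le_right (a₁ * a₂ * a₃) (b₁ * b₂ * b₃))
  calc min (a₁ * a₂ * a₃) (b₁ * b₂ * b₃)
      ≤ (1 - s) ^ 3 * (a₁ * a₂ * a₃) + 3 * s * (1 - s) ^ 2 * ((b₁ * a₂ * a₃ + a₁ * b₂ * a₃ + a₁ * a₂ * b₃) / 3) +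
          3 * s ^ 2 * (1 - s) * ((a₁ * b₂ * b₃ + b₁ * a₂ * b₃ + b₁ * b₂ * a₃) / 3) + s ^ 3 * (b₁ * b₂ * b₃) := key
    _ = ((1 - s) * a₁ + s * b₁) * ((1 - s) * a₂ + s * b₂) * ((1 - s) * a₃ + s * b₃) := by ring

/-! ### The fibre of a nested triple and the slice inequality at every coin -/

/-- **The fibre of a NESTED triple along `e`**: with `u_i = M_s(1_{U_i})`,
`E_3(μ_{p[e↦s]}; 1_{U₁},1_{U₂},1_{U₃}) = u₁·(1 − u₂)·(2 − u₃)`. [this work] -/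
theorem sahiE_three_chain_update (p : ι → unitInterval) (e : ι) (s : unitInterval) {U₁ U₂ U₃ : Set (Set ι)}
    (h12 : U₁ ⊆ U₂) (h23 : U₂ ⊆ U₃) :
    sahiE (bernoulliWeight (update p e s)) 3 ![ind U₁, ind U₂, ind U₃] =
      ((s : ℝ) * secEx p e (ind U₁) true + (1 - (s : ℝ)) * secEx p e (ind U₁) false) *
        (1 - ((s : ℝ) * secEx p e (ind U₂) true + (1 - (s : ℝ)) * secEx p e (ind U₂) false)) *
          (2 - ((s : ℝ) * secEx p e (ind U₃) true + (1 - (s : ℝ)) * secEx p e (ind U₃) false)) := by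
  have e12 : ind U₁ * ind U₂ = ind U₁ := ind_mul_ind_eq_of_subset h12
  have e13 : ind U₁ * ind U₃ = ind U₁ := ind_mul_ind_eq_of_subset (h12.trans h23)
  have e23 : ind U₂ * ind U₃ = ind U₂ := ind_mul_ind_eq_of_subset h23
  rw [sahiE_three, e12, e13, e23]
  simp only [ex_update_eq]
  ring

/-- **THE SLICE MINIMUM PRINCIPLE AT EVERY COIN FOR NESTED TRIPLES** (min form): for events `U₁ ⊆ U₂ ⊆ U₃`, every coin
`e` and every `s ∈ [0,1]`, `min(E_3(μ_{p[e↦0]}), E_3(μ_{p[e↦1]})) ≤ E_3(μ_{p[e↦s]})`. [this work] -/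
theorem chain_slice_min_le (p : ι → unitInterval) (e : ι) (s : unitInterval) {U₁ U₂ U₃ : Set (Set ι)} (h12 : U₁ ⊆ U₂)
    (h23 : U₂ ⊆ U₃) :
    min (sahiE (bernoulliWeight (update p e 0)) 3 ![ind U₁, ind U₂, ind U₃])
        (sahiE (bernoulliWeight (update p e 1)) 3 ![ind U₁, ind U₂, ind U₃]) ≤
      sahiE (bernoulliWeight (update p e s)) 3 ![ind U₁, ind U₂, ind U₃] := by
  have h0 := sahiE_three_chain_update p e 0 h12 h23
  have h1 := sahiE_three_chain_update p e 1 h12 h23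
  rw [Set.Icc.coe_zero] at h0
  rw [Set.Icc.coe_one] at h1
  have e0 : sahiE (bernoulliWeight (update p e 0)) 3 ![ind U₁, ind U₂, ind U₃] =
      secEx p e (ind U₁) false * (1 - secEx p e (ind U₂) false) * (2 - secEx p e (ind U₃) false) := by
    rw [h0]; ring
  have e1 : sahiE (bernoulliWeight (update p e 1)) 3 ![ind U₁, ind U₂, ind U₃] =
      secEx p e (ind U₁) true * (1 - secEx p e (ind U₂) true) * (2 - secEx p e (ind U₃) true) := by
    rw [h1]; ring
  have hs : sahiE (bernoulliWeight (update p e s)) 3 ![ind U₁, ind U₂, ind U₃] =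
      ((1 - (s : ℝ)) * secEx p e (ind U₁) false + (s : ℝ) * secEx p e (ind U₁) true) *
        ((1 - (s : ℝ)) * (1 - secEx p e (ind U₂) false) + (s : ℝ) * (1 - secEx p e (ind U₂) true)) *
          ((1 - (s : ℝ)) * (2 - secEx p e (ind U₃) false) + (s : ℝ) * (2 - secEx p e (ind U₃) true)) := by
    rw [sahiE_three_chain_update p e s h12 h23]; ring
  rw [e0, e1, hs]
  have m1 := secEx_ind_mem p e U₁; have m2 := secEx_ind_mem p e U₂; have m3 := secEx_ind_mem p e U₃
  exact prod3_affine_ge_min s.2.1 s.2.2 (m1 false).1 (by linarith [(m2 false).2]) (by linarith [(m3 false).2])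
    (m1 true).1 (by linarith [(m2 true).2]) (by linarith [(m3 true).2])

/-- **The slice minimum principle holds at EVERY live coin for nested triples `U₁ ⊆ U₂ ⊆ U₃`** (the form used by
`SliceMinimumPrinciple`: some `b ∈ {0,1}` with `E_3(μ_{p[e↦b]}) ≤ E_3(μ_p)`). [this work] -/
theorem sliceMinimum_chain (p : ι → unitInterval) {U₁ U₂ U₃ : Set (Set ι)} (h12 : U₁ ⊆ U₂) (h23 : U₂ ⊆ U₃) (e : ι) :
    ∃ b : unitInterval, ((b : ℝ) = 0 ∨ (b : ℝ) = 1) ∧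
      sahiE (bernoulliWeight (update p e b)) 3 ![ind U₁, ind U₂, ind U₃] ≤
        sahiE (bernoulliWeight p) 3 ![ind U₁, ind U₂, ind U₃] := by
  have key := chain_slice_min_le p e (p e) h12 h23
  rw [update_eq_self] at key
  rcases min_le_iff.1 key with h | h
  · exact ⟨0, Or.inl Set.Icc.coe_zero, h⟩
  · exact ⟨1, Or.inr Set.Icc.coe_one, h⟩

end SahiSliceMinimum

end Summit.CriticalPhenomena.PercolationContinuityZ3.Theorems
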